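/-
Copyright (c) 2026 the pub-hodgecm-mathlib formalisation cell (harness21).  Prover seat hodgecm-mathlib-LH7-p08 (g0) (re-dealt to strike line L3 `stub_N6nsDyadic` by director
s1969 (a)), Track A «(D-RAM) FOUR-FRAME» squad, helper lane on h413 = stmt-HodgeConjecture-24833 (count-neutral).  β-BOARD v1 row R8 ∕ (P5) «H `(2ρ,2ρ,2ρ)`» (sub-dealer LH4-p05
(g8); F0P3a-p01 (g37) `hRest` coverage ledger «H(ρ): 0 unless 2ρ = m − ℓ₀»), FILE 1: the clean-shell read on the core-hanging stratum and its token-free zero.  2026-09-04.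
-/
import Summits.HodgeConjecture.HodgeConjecture.Theorems.F0P3cDyRamLabelledCoreHangingStratumRead   -- ★ (LH4-p09 (g8)): brings ★ B7 `stratum_H_eq`, ★ p859257 `latticeInLevel_diagonal_latt_G1_iff`, ★ p859094 `finsum_mem_sep_eq_ite_of_forall_iff`
import Summits.HodgeConjecture.HodgeConjecture.Theorems.F0P3cDyRamLabelledKappaSplitStrata          -- ★ (F0P3a-p01 (g36)): `v_le_pow_iff_of_eq`
import Summits.HodgeConjecture.HodgeConjecture.Theorems.F0P3cDyRamLabelledOddCountDefs              -- ★ p860257 DEFS (LH4-p11 (g8)): `labelledOddCount`, `valueClassLabel`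
import Summits.HodgeConjecture.HodgeConjecture.Theorems.F0P3cDyRamElementDatumParity                -- ★ (LH4-p10 (g2)): `isoceles_of_isElementDatum`
import Summits.HodgeConjecture.HodgeConjecture.Theorems.F0P3cDyRamStageOneBDefs                     -- ★ DEFS №5: `mcOfRecord`; brings `mstarOfRecord`
import HarnessLib

/-!
# Crux `H413`, line LH4 «(D-RAM) FOUR-FRAME» — (β) table, β-BOARD row R8 ∕ (P5), FILE 1: THE CLEAN-SHELL READ ON THE CORE-HANGING STRATUM `H(ρ) = (2ρ, 2ρ, 2ρ)` —
# «on a non-equilateral key the clean shell keeps ALL of `H(ρ)` when `2ρ + ℓ₀ = min(n₁, n₂)` and NOTHING otherwise», and the token-free zero of the labelled-odd table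

Cell `hodgecm-mathlib` (D-0151), FLOOR 0, crux item H413 = `stmt-HodgeConjecture-24833`, route `HCCMUnconditional`; squad F0∕P3c∕LH4.  THEOREMS ONLY (no `def`, no instance, no
notation, no `sorry`, default heartbeats); ★-only imports; lane `--supports stmt-HodgeConjecture-24833 --as helper` (count-neutral); pays NO row, states NO law.

THE MATHEMATICS (this seat's H-ROW DERIVATION v1 e4da7f0103cc4a29 §1; F0P3a-p01 (g37) `hRest` coverage ledger 15:16:06Z «H(ρ), ρ ≥ 1: value 0 unless `2ρ = m − ℓ₀`»).  ★ B7
`stratum_H_eq` writes every member of the core-hanging stratum `stratum σ ϖ T (2ρ,2ρ,2ρ)` (`ρ ≥ 1`) as `latt(1 0 0; x ϖ^ρ 0; xζ+y″ ϖ^ρζ ϖ^{2ρ})` with `|x| = |ζ| = |y″| = |xζ+y″| = 1`;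
★ p859257's G1 level read at `s = 0` gives `diag(a, b, 0)·M ⊆ ϖ^ℓ M ↔ |a|,|b| ≤ |ϖ|^ℓ ∧ |b − a| ≤ |ϖ|^{ℓ+ρ} ∧ |b| ≤ |ϖ|^{ℓ+ρ} ∧ |xζ·b + a·y″| ≤ |ϖ|^{ℓ+2ρ}` (§1).  The mixed
letter is EXACT — `|xζ·b + a·y″| = |ϖ|^{min(v a, v b)}` — as soon as `v a ≠ v b`, OR `v a = v b < v(b − a)` (then `xζ·b + a·y″ = b·(xζ+y″) + (a−b)·y″` and `|xζ+y″| = 1`): this is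
the ISOSCELES NON-EQUILATERAL key at `(a, b) = (α−1, β−1)` (`(v a, v b, v(b−a)) = (n₂, n₁, n₃)`; LH4-p09's ★ `…_of_ne` covers `n₁ ≠ n₂` only — §1 adds the on-locus case
`n₁ = n₂ < n₃`, where the unit `xζ + y″` never cancels against the deeper root), so `diag(α−1, β−1, 0)·M ⊆ ϖ^ℓ M ↔ ℓ + 2ρ ≤ min(n₁, n₂)` (the letter `ℓ + ρ ≤ n₃` is implied by
isosceles) (§2).  Hence on `H(ρ)` the three clean-shell tokens `(ℓ₀ ∣ ¬(ℓ₀+1) ∣ X² at mcOfRecord d)` hold iff `2ρ + ℓ₀ = min(n₁, n₂)` (the square token is automatic from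
`mcOfRecord d ≤ N₀`), and the labelled-odd table of the clean-shell cut of `H(ρ)` is `0` whenever `2ρ + ℓ₀ ≠ min(n₁, n₂)` — the token-free zero twin of the R8 row (§3); the value AT
`2ρ + ℓ₀ = min(n₁, n₂)` (two-slot regime, general `q`) is FILE 2.  Not here: the equilateral key `n₁ = n₂ = n₃` (there the mixed letter cancels on one residue class of `y″∕(xζ)` and
the shell cuts INSIDE the stratum — the glue foot of ★ B7).
HONEST LABEL.  Count-neutral (`--supports`); nothing printed is asserted; pays NO tier-0 row; the R8 value, `hRest`, (T3), (β-BAL), (β), T₊ stay OPEN; `HC_CM` is proved only modulo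
the 7 printed citations (2 remaining named inputs: hLiu418 = `stmt-HodgeConjecture-24832`, h413 = `stmt-HodgeConjecture-24833`) until rung 0 closes.

## References
* [Serre1980Trees] J.-P. Serre, *Trees*, Springer (1980), Ch. II §1.1 (lattices, Hermite normal forms).
* [Kottwitz1986BaseChangeUnits] R. E. Kottwitz, *Base change for unit elements of Hecke algebras*, Compositio Math. 60 (1986), §1 pp. 240–241 (lattice counts modulo the torus).
* [Rogawski1990] J. D. Rogawski, *Automorphic Representations of Unitary Groups in Three Variables*, Ann. of Math. Stud. 123 (1990), §4.9 Prop. 4.9.1 (a)(b) p. 55.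
-/

set_option autoImplicit false

noncomputable section

namespace Summit.HodgeConjecture.HodgeConjecture.Cruxes.H413.F0P3cDyRamLabelledOddCoreHangingShell

open Matrix WithZero
open Literature.NumberTheory.Automorphic Literature.NumberTheory.Automorphic.HermitianLattice
open Literature.NumberTheory.Automorphic.UnitaryLatticeTree Literature.NumberTheory.Automorphic.UnitaryThreeFourFrame
open Literature.NumberTheory.LocalFields Literature.NumberTheory.LocalFields.WildQuadraticDatum
open Summit.HodgeConjecture.HodgeConjecture.Cruxes.H413.F0P3cDyRamDiagonalTorusDefs
open Summit.HodgeConjecture.HodgeConjecture.Cruxes.H413.F0P3cDyRamDiagonalStrataDefs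
open Summit.HodgeConjecture.HodgeConjecture.Cruxes.H413.F0P3cDyRamFourFrameCensusDefs
open Summit.HodgeConjecture.HodgeConjecture.Cruxes.H413.F0P3cDyRamFourFramePieces (mstarOfRecord)
open Summit.HodgeConjecture.HodgeConjecture.Cruxes.H413.F0P3cDyRamStageOneBDefs
open Summit.HodgeConjecture.HodgeConjecture.Cruxes.H413.F0P3cDyRamLabelledOddCountDefs
open Summit.HodgeConjecture.HodgeConjecture.Cruxes.H413.F0P3cDyRamDiagonalCoreHangingSocket (stratum_H_eq)
open Summit.HodgeConjecture.HodgeConjecture.Cruxes.H413.F0P3cDyRamLabelledGluedStratumRead (latticeInLevel_diagonal_latt_G1_iff)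
open Summit.HodgeConjecture.HodgeConjecture.Cruxes.H413.F0P3cDyRamLabelledSplitStrata (finsum_mem_sep_eq_ite_of_forall_iff)
open Summit.HodgeConjecture.HodgeConjecture.Cruxes.H413.F0P3cDyRamLabelledKappaSplitStrata (v_le_pow_iff_of_eq)
open Summit.HodgeConjecture.HodgeConjecture.Cruxes.H413.F0P3cDyRamElementDatumParity (isoceles_of_isElementDatum)
open scoped Valued WithZero Matrix MatrixGroups

/-! ## §1  The diagonal level token on the core-hanging normal form: the general read and the exact mixed letter -/

section Read

variable {K : Type*} [Field K] [Valued K ℤᵐ⁰]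

/-- **THE DIAGONAL LEVEL TOKEN ON THE CORE-HANGING NORMAL FORM** `latt(1 0 0; x ϖ^ρ 0; xζ+y″ ϖ^ρζ ϖ^{2ρ})` (`|x| = |ζ| = 1`, `y″` arbitrary), at `e = (a, b, 0)`:
`diag(a,b,0)·M ⊆ ϖ^ℓ M ↔ (|a| ≤ |ϖ|^ℓ ∧ |b| ≤ |ϖ|^ℓ) ∧ |b − a| ≤ |ϖ|^{ℓ+ρ} ∧ |b| ≤ |ϖ|^{ℓ+ρ} ∧ |xζ·b + a·y″| ≤ |ϖ|^{ℓ+2ρ}` — ★ p859257 `latticeInLevel_diagonal_latt_G1_iff` at `s = 0`.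
[cite: Serre1980Trees, Ch. II §1.1] [cite: Kottwitz1986BaseChangeUnits, §1 pp. 240–241] -/
theorem latticeInLevel_diag_latt_H_iff {ϖ : K} (hϖ : ϖ ≠ 0) (ℓ ρ : ℕ) (a b : K) {x ζ : K} (hx : Valued.v x = 1) (hζ : Valued.v ζ = 1) (y'' : K) :
    LatticeInLevel ϖ ℓ (Matrix.diagonal ![a, b, 0]) (latt (!![1, 0, 0; x, ϖ ^ ρ, 0; x * ζ + y'', ϖ ^ ρ * ζ, ϖ ^ (2 * ρ)] : Matrix (Fin 3) (Fin 3) K)) ↔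
      (Valued.v a ≤ Valued.v ϖ ^ ℓ ∧ Valued.v b ≤ Valued.v ϖ ^ ℓ) ∧ Valued.v (b - a) ≤ Valued.v ϖ ^ (ℓ + ρ) ∧ Valued.v b ≤ Valued.v ϖ ^ (ℓ + ρ) ∧
        Valued.v (x * ζ * b + a * y'') ≤ Valued.v ϖ ^ (ℓ + 2 * ρ) := by
  have h := latticeInLevel_diagonal_latt_G1_iff hϖ ℓ ρ 0 ![a, b, 0] hx hζ y''
  simp only [Nat.add_zero, Matrix.cons_val_zero, Matrix.cons_val_one, Matrix.cons_val_two, Matrix.tail_cons, Matrix.head_cons, map_zero, zero_le, and_true,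
    zero_sub, Valuation.map_neg] at h
  rw [h, show x * ζ * -b + -a * y'' = -(x * ζ * b + a * y'') by ring, Valuation.map_neg]

/-- **THE MIXED LETTER IS EXACT OFF THE EQUILATERAL LOCUS.**  `|x| = |ζ| = |y″| = 1`, `|xζ + y″| = 1`; `|a| = |ϖ|^{n_a}`, `|b| = |ϖ|^{n_b}`, `|b − a| = |ϖ|^{n_c}`, and
`n_a ≠ n_b ∨ n_a < n_c`.  Then `|xζ·b + a·y″| = |ϖ|^{min(n_a, n_b)}`: off the diagonal the two terms have different sizes; on it (`n_a = n_b < n_c`)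
`xζ·b + a·y″ = b·(xζ + y″) + (a − b)·y″` with `|b·(xζ+y″)| = |ϖ|^{n_b} > |(a−b)·y″|`. [cite: Serre1980Trees, Ch. II §1.1] -/
theorem v_mixed_eq_of_ne_or_lt {ϖ : K} (hϖ : Valued.v ϖ = exp (-1 : ℤ)) {x ζ y'' : K} (hx : Valued.v x = 1) (hζ : Valued.v ζ = 1)
    (hy : Valued.v y'' = 1) (hxy : Valued.v (x * ζ + y'') = 1)
    {a b : K} {na nb nc : ℕ} (ha : Valued.v a = Valued.v ϖ ^ na) (hb : Valued.v b = Valued.v ϖ ^ nb) (hc : Valued.v (b - a) = Valued.v ϖ ^ nc)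
    (hkey : na ≠ nb ∨ na < nc) :
    Valued.v (x * ζ * b + a * y'') = Valued.v ϖ ^ min na nb := by
  have hlt : ∀ p r : ℕ, Valued.v ϖ ^ p < Valued.v ϖ ^ r ↔ r < p := fun p r => by
    rw [v_varpi_pow hϖ, v_varpi_pow hϖ, exp_lt_exp]; omega
  have hxζb : Valued.v (x * ζ * b) = Valued.v ϖ ^ nb := by rw [map_mul, map_mul, hx, hζ, one_mul, one_mul, hb]
  have hay : Valued.v (a * y'') = Valued.v ϖ ^ na := by rw [map_mul, ha, hy, mul_one]
  rcases Nat.lt_or_ge na nb with h₁ | h₁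
  · -- `|a y″| > |xζ b|`
    rw [Nat.min_eq_left h₁.le, Valuation.map_add_eq_of_lt_right, hay]
    rw [hxζb, hay, hlt]; exact h₁
  · rcases h₁.lt_or_eq with h₂ | h₂
    · -- `|xζ b| > |a y″|`
      rw [Nat.min_eq_right h₂.le, Valuation.map_add_eq_of_lt_left, hxζb]
      rw [hxζb, hay, hlt]; exact h₂
    · -- `n_a = n_b < n_c`
      subst h₂
      have h₃ : nb < nc := hkey.elim (fun h => absurd rfl h) id
      have hmain : Valued.v (b * (x * ζ + y'')) = Valued.v ϖ ^ nb := by rw [map_mul, hxy, mul_one, hb]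
      have hsmall : Valued.v ((a - b) * y'') < Valued.v (b * (x * ζ + y'')) := by
        rw [hmain, map_mul, hy, mul_one, show a - b = -(b - a) by ring, Valuation.map_neg, hc, hlt]; exact h₃
      rw [Nat.min_self, show x * ζ * b + a * y'' = b * (x * ζ + y'') + (a - b) * y'' by ring, Valuation.map_add_eq_of_lt_left _ hsmall, hmain]

/-- **THE READ AT `(a, b, 0)` WITH EXACT DEPTHS, OFF THE EQUILATERAL LOCUS**: `|ϖ| = exp(−1)`, the normal-form units as above, `|a| = |ϖ|^{n_a}`, `|b| = |ϖ|^{n_b}`,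
`|b − a| = |ϖ|^{n_c}` with `n_c ≥ min(n_a, n_b)` and (`n_a ≠ n_b` or `n_a < n_c`):  `diag(a, b, 0)·M ⊆ ϖ^ℓ M ↔ ℓ + 2ρ ≤ n_a ∧ ℓ + 2ρ ≤ n_b ∧ ℓ + ρ ≤ n_c`.
[cite: Serre1980Trees, Ch. II §1.1] [cite: Kottwitz1986BaseChangeUnits, §1 pp. 240–241] -/
theorem latticeInLevel_diag_latt_H_iff_of_depths {ϖ : K} (hϖ : Valued.v ϖ = exp (-1 : ℤ)) (ℓ ρ : ℕ) {x ζ y'' : K} (hx : Valued.v x = 1) (hζ : Valued.v ζ = 1)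
    (hy : Valued.v y'' = 1) (hxy : Valued.v (x * ζ + y'') = 1)
    {a b : K} {na nb nc : ℕ} (ha : Valued.v a = Valued.v ϖ ^ na) (hb : Valued.v b = Valued.v ϖ ^ nb) (hc : Valued.v (b - a) = Valued.v ϖ ^ nc)
    (hkey : na ≠ nb ∨ na < nc) :
    LatticeInLevel ϖ ℓ (Matrix.diagonal ![a, b, 0]) (latt (!![1, 0, 0; x, ϖ ^ ρ, 0; x * ζ + y'', ϖ ^ ρ * ζ, ϖ ^ (2 * ρ)] : Matrix (Fin 3) (Fin 3) K)) ↔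
      ℓ + 2 * ρ ≤ na ∧ ℓ + 2 * ρ ≤ nb ∧ ℓ + ρ ≤ nc := by
  have hϖ0 : ϖ ≠ 0 := (Valuation.ne_zero_iff Valued.v).1 (by rw [hϖ]; exact exp_ne_zero)
  have hle : ∀ p r : ℕ, Valued.v ϖ ^ p ≤ Valued.v ϖ ^ r ↔ r ≤ p := fun p r => by
    rw [v_varpi_pow hϖ, v_varpi_pow hϖ, exp_le_exp]; omega
  rw [latticeInLevel_diag_latt_H_iff hϖ0 ℓ ρ a b hx hζ y'', v_mixed_eq_of_ne_or_lt hϖ hx hζ hy hxy ha hb hc hkey, ha, hb, hc, hle, hle, hle, hle, hle]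
  constructor
  · rintro ⟨-, h₃, -, h⟩
    exact ⟨h.trans (min_le_left _ _), h.trans (min_le_right _ _), h₃⟩
  · rintro ⟨h₁, h₂, h₃⟩
    exact ⟨⟨by omega, by omega⟩, h₃, by omega, le_min h₁ h₂⟩

end Read

/-! ## §2  On `H(ρ)` at the element letters: the `X`-token reads `ℓ + 2ρ ≤ min(n₁, n₂)`; the clean shell reads `2ρ + ℓ₀ = min(n₁, n₂)` -/

section Shell

variable {K : Type} [Field K] [Valued K ℤᵐ⁰] {σ : K →+* K} {ϖ : K} {d t : ℕ} {α β : K} {N₀ n₁ n₂ n₃ : ℕ}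

/-- **THE `X`-TOKEN ON `H(ρ)`, NON-EQUILATERAL KEY.**  For an element datum (`|α−1| = |ϖ|^{n₂}`, `|β−1| = |ϖ|^{n₁}`, `|α−β| = |ϖ|^{n₃}`, isosceles by ★ `isoceles_of_isElementDatum`)
with `¬(n₁ = n₂ = n₃)` and every `M ∈ stratum σ ϖ T (2ρ,2ρ,2ρ)` (`ρ ≥ 1`): `diag(α−1, β−1, 0)·M ⊆ ϖ^ℓ M ↔ ℓ + 2ρ ≤ min(n₁, n₂)` (the letter `ℓ + ρ ≤ n₃` is implied).
[cite: Kottwitz1986BaseChangeUnits, §1 pp. 240–241] [cite: Rogawski1990, §4.9 Prop. 4.9.1 (a) p. 55] -/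
theorem latticeInLevel_X_iff_of_mem_stratum_H (hD : IsRamifiedQuadraticDatum σ ϖ d t) (hE : IsElementDatum σ ϖ N₀ α β n₁ n₂ n₃) (hneq : ¬ (n₁ = n₂ ∧ n₂ = n₃))
    (T : GL (Fin 3) K) {ρ : ℕ} (hρ : 1 ≤ ρ) {M : Submodule 𝒪[K] (Fin 3 → K)} (hM : M ∈ stratum σ ϖ T ![2 * ρ, 2 * ρ, 2 * ρ]) (ℓ : ℕ) :
    LatticeInLevel ϖ ℓ (Matrix.diagonal ![α - 1, β - 1, 0]) M ↔ ℓ + 2 * ρ ≤ min n₁ n₂ := by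
  have hiso := isoceles_of_isElementDatum hD hE
  obtain ⟨-, hvσ, hϖ, hfix, -, -, -⟩ := id hD
  have hα : Valued.v (α - 1) = Valued.v ϖ ^ n₂ := hE.2.2.2.2.2.2.1
  have hβ : Valued.v (β - 1) = Valued.v ϖ ^ n₁ := hE.2.2.2.2.2.1
  have hγ : Valued.v (β - 1 - (α - 1)) = Valued.v ϖ ^ n₃ := by
    rw [show β - 1 - (α - 1) = -(α - β) by ring, Valuation.map_neg]; exact hE.2.2.2.2.2.2.2.1
  rw [stratum_H_eq hvσ hfix hϖ T hρ] at hM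
  obtain ⟨-, -, x, ζ, y'', hx, hζ, hy, hxy, rfl⟩ := hM
  rw [latticeInLevel_diag_latt_H_iff_of_depths hϖ ℓ ρ hx hζ hy hxy hα hβ hγ (by omega)]
  constructor
  · rintro ⟨h₁, h₂, -⟩; exact le_min h₂ h₁
  · intro h
    have h₁ := (le_min_iff.1 h).1
    have h₂ := (le_min_iff.1 h).2
    exact ⟨h₂, h₁, by omega⟩

/-- **THE SQUARE TOKEN ON `H(ρ)` IS AUTOMATIC AT `2ρ + ℓ₀ = min(n₁, n₂)`** (`mcOfRecord d ≤ N₀`, non-equilateral key): `diag((α−1)², (β−1)², 0)·M ⊆ ϖ^{mc} M` for every member of the stratum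
(the letters are `mc ≤ 2n₁, 2n₂`, `mc + ρ ≤ n₃ + min`, `mc + ρ ≤ 2n₁` and the mixed one `mc + 2ρ ≤ 2·min(n₁,n₂)`, all below `mc ≤ N₀ ≤ min ≤ n₃`).
[cite: Kottwitz1986BaseChangeUnits, §1 pp. 240–241] [cite: Rogawski1990, §4.9 Prop. 4.9.1 (a) p. 55] -/
theorem latticeInLevel_sq_of_mem_stratum_H (hD : IsRamifiedQuadraticDatum σ ϖ d t) (hE : IsElementDatum σ ϖ N₀ α β n₁ n₂ n₃) (hmc : mcOfRecord d ≤ N₀)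
    (T : GL (Fin 3) K) {ρ : ℕ} (hρ : 1 ≤ ρ) {M : Submodule 𝒪[K] (Fin 3 → K)} (hM : M ∈ stratum σ ϖ T ![2 * ρ, 2 * ρ, 2 * ρ]) (h2ρ : 2 * ρ + d % 2 = min n₁ n₂) :
    LatticeInLevel ϖ (mcOfRecord d) (Matrix.diagonal ![(α - 1) * (α - 1), (β - 1) * (β - 1), 0]) M := by
  have hiso := isoceles_of_isElementDatum hD hE
  obtain ⟨-, hvσ, hϖ, hfix, -, -, -⟩ := id hD
  have hϖ0 : ϖ ≠ 0 := (Valuation.ne_zero_iff Valued.v).1 (by rw [hϖ]; exact exp_ne_zero)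
  have hα : Valued.v (α - 1) = Valued.v ϖ ^ n₂ := hE.2.2.2.2.2.2.1
  have hβ : Valued.v (β - 1) = Valued.v ϖ ^ n₁ := hE.2.2.2.2.2.1
  have hγ : Valued.v (β - 1 - (α - 1)) = Valued.v ϖ ^ n₃ := by
    rw [show β - 1 - (α - 1) = -(α - β) by ring, Valuation.map_neg]; exact hE.2.2.2.2.2.2.2.1
  have hn₁ : N₀ ≤ n₁ := hE.2.2.2.2.2.2.2.2.1
  have hn₂ : N₀ ≤ n₂ := hE.2.2.2.2.2.2.2.2.2.1
  have hn₃ : N₀ ≤ n₃ := hE.2.2.2.2.2.2.2.2.2.2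
  have hle : ∀ p r : ℕ, Valued.v ϖ ^ p ≤ Valued.v ϖ ^ r ↔ r ≤ p := fun p r => by
    rw [v_varpi_pow hϖ, v_varpi_pow hϖ, exp_le_exp]; omega
  rw [stratum_H_eq hvσ hfix hϖ T hρ] at hM
  obtain ⟨-, -, x, ζ, y'', hx, hζ, hy, hxy, rfl⟩ := hM
  rw [latticeInLevel_diag_latt_H_iff hϖ0 (mcOfRecord d) ρ _ _ hx hζ y'']
  have hα2 : Valued.v ((α - 1) * (α - 1)) = Valued.v ϖ ^ (2 * n₂) := by rw [map_mul, hα, ← pow_add, two_mul]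
  have hβ2 : Valued.v ((β - 1) * (β - 1)) = Valued.v ϖ ^ (2 * n₁) := by rw [map_mul, hβ, ← pow_add, two_mul]
  refine ⟨⟨?_, ?_⟩, ?_, ?_, ?_⟩
  · rw [hα2, hle]; omega
  · rw [hβ2, hle]; omega
  · -- `(β−1)² − (α−1)² = (β−1−(α−1))·((β−1)+(α−1))`
    rw [show (β - 1) * (β - 1) - (α - 1) * (α - 1) = (β - 1 - (α - 1)) * ((β - 1) + (α - 1)) by ring, map_mul, hγ]
    have hsum : Valued.v ((β - 1) + (α - 1)) ≤ Valued.v ϖ ^ min n₁ n₂ := by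
      refine (Valuation.map_add _ _ _).trans (max_le ?_ ?_)
      · rw [hβ, hle]; exact min_le_left _ _
      · rw [hα, hle]; exact min_le_right _ _
    calc Valued.v ϖ ^ n₃ * Valued.v ((β - 1) + (α - 1)) ≤ Valued.v ϖ ^ n₃ * Valued.v ϖ ^ min n₁ n₂ := mul_le_mul' le_rfl hsum
      _ = Valued.v ϖ ^ (n₃ + min n₁ n₂) := (pow_add _ _ _).symm
      _ ≤ Valued.v ϖ ^ (mcOfRecord d + ρ) := by rw [hle]; omega
  · rw [hβ2, hle]; omega
  · refine (Valuation.map_add _ _ _).trans (max_le ?_ ?_)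
    · rw [map_mul, map_mul, hx, hζ, one_mul, one_mul, hβ2, hle]; omega
    · rw [map_mul, hy, mul_one, hα2, hle]; omega

/-- **THE CLEAN-SHELL READ ON `H(ρ)` (token-free), NON-EQUILATERAL KEY**: for every member of `stratum σ ϖ T (2ρ,2ρ,2ρ)` (`ρ ≥ 1`; `mcOfRecord d ≤ N₀`) the three shell tokens
`X·M ⊆ ϖ^{ℓ₀}M`, `X·M ⊄ ϖ^{ℓ₀+1}M`, `X²·M ⊆ ϖ^{mc}M` (`X = diag(α−1, β−1, 0)`, `ℓ₀ = d % 2`, `mc = mcOfRecord d`) hold iff `2ρ + ℓ₀ = min(n₁, n₂)`.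
[cite: Kottwitz1986BaseChangeUnits, §1 pp. 240–241] [cite: Rogawski1990, §4.9 Prop. 4.9.1 (a) p. 55] -/
theorem shell_iff_of_mem_stratum_H (hD : IsRamifiedQuadraticDatum σ ϖ d t) (hE : IsElementDatum σ ϖ N₀ α β n₁ n₂ n₃) (hmc : mcOfRecord d ≤ N₀)
    (hneq : ¬ (n₁ = n₂ ∧ n₂ = n₃)) (T : GL (Fin 3) K) {ρ : ℕ} (hρ : 1 ≤ ρ) :
    ∀ M ∈ stratum σ ϖ T ![2 * ρ, 2 * ρ, 2 * ρ],
      (LatticeInLevel ϖ (d % 2) (Matrix.diagonal ![α - 1, β - 1, 0]) M ∧ ¬ LatticeInLevel ϖ (d % 2 + 1) (Matrix.diagonal ![α - 1, β - 1, 0]) M ∧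
          LatticeInLevel ϖ (mcOfRecord d) (Matrix.diagonal ![(α - 1) * (α - 1), (β - 1) * (β - 1), 0]) M) ↔ 2 * ρ + d % 2 = min n₁ n₂ := by
  intro M hM
  rw [latticeInLevel_X_iff_of_mem_stratum_H hD hE hneq T hρ hM, latticeInLevel_X_iff_of_mem_stratum_H hD hE hneq T hρ hM]
  constructor
  · rintro ⟨h₁, h₂, -⟩; omega
  · intro h
    exact ⟨by omega, by omega, latticeInLevel_sq_of_mem_stratum_H hD hE hmc T hρ hM h⟩

end Shell

/-! ## §3  The token-free zero of the labelled-odd table of `H(ρ)` off `2ρ + ℓ₀ = min(n₁, n₂)` -/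

section Table

variable {K : Type} [Field K] [Valued K ℤᵐ⁰] {σ : K →+* K} {ϖ : K} {d t : ℕ} {α β : K} {N₀ n₁ n₂ n₃ : ℕ}

/-- **`H(ρ)` OFF `2ρ + ℓ₀ = min(n₁, n₂)`, TOKEN-FREE** (F0P3a-p01 (g37) `hRest` ledger «H(ρ): 0 unless 2ρ = m − ℓ₀»): on a non-equilateral key, if `2ρ + d % 2 ≠ min n₁ n₂` the
clean-shell cut of the core-hanging stratum `(2ρ, 2ρ, 2ρ)` is EMPTY, so its labelled-odd table is `0` in every slot `i` (any label level; here the (β) label of record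
`valueClassLabel σ ϖ (α−1) (β−1) m* d`, `m* = mstarOfRecord d`). [cite: Kottwitz1986BaseChangeUnits, §1 pp. 240–241] [cite: Rogawski1990, §4.9 Prop. 4.9.1 (a)(b) p. 55] -/
theorem finsum_stratum_H_shell_labelledOdd_div_relIndex_eq_zero_of_ne (hD : IsRamifiedQuadraticDatum σ ϖ d t) (hE : IsElementDatum σ ϖ N₀ α β n₁ n₂ n₃)
    (hmc : mcOfRecord d ≤ N₀) (hneq : ¬ (n₁ = n₂ ∧ n₂ = n₃)) (T : GL (Fin 3) K) (ρ : ℕ) (hρ : 1 ≤ ρ) (hne : 2 * ρ + d % 2 ≠ min n₁ n₂) (i : Fin 3) :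
    ∑ᶠ M ∈ {M : Submodule 𝒪[K] (Fin 3 → K) | M ∈ stratum σ ϖ T ![2 * ρ, 2 * ρ, 2 * ρ] ∧
        (LatticeInLevel ϖ (d % 2) (Matrix.diagonal ![α - 1, β - 1, 0]) M ∧ ¬ LatticeInLevel ϖ (d % 2 + 1) (Matrix.diagonal ![α - 1, β - 1, 0]) M ∧
          LatticeInLevel ϖ (mcOfRecord d) (Matrix.diagonal ![(α - 1) * (α - 1), (β - 1) * (β - 1), 0]) M)},
      (labelledOddCount σ ϖ 0 i (valueClassLabel σ ϖ (α - 1) (β - 1) (mstarOfRecord d) d) M : ℚ) /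
        ((((unitStabilizer M).map (unitNormMap σ 3)).relIndex (fixedUnitTorus σ 3) : ℕ) : ℚ) = 0 := by
  classical
  rw [finsum_mem_sep_eq_ite_of_forall_iff (stratum σ ϖ T ![2 * ρ, 2 * ρ, 2 * ρ]) _ _ (shell_iff_of_mem_stratum_H hD hE hmc hneq T hρ), if_neg hne]

/-- **THE SAME ZERO FOR ANY WEIGHT** (e.g. `stabiliserWeight`, or `kappaCount·stabiliserWeight` for the κ-tables): off `2ρ + ℓ₀ = min(n₁, n₂)` the clean-shell cut of `H(ρ)`
carries finsum `0` of every function. [cite: Kottwitz1986BaseChangeUnits, §1 pp. 240–241] -/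
theorem finsum_stratum_H_shell_eq_zero_of_ne (hD : IsRamifiedQuadraticDatum σ ϖ d t) (hE : IsElementDatum σ ϖ N₀ α β n₁ n₂ n₃)
    (hmc : mcOfRecord d ≤ N₀) (hneq : ¬ (n₁ = n₂ ∧ n₂ = n₃)) (T : GL (Fin 3) K) (ρ : ℕ) (hρ : 1 ≤ ρ) (hne : 2 * ρ + d % 2 ≠ min n₁ n₂)
    (w : Submodule 𝒪[K] (Fin 3 → K) → ℚ) :
    ∑ᶠ M ∈ {M : Submodule 𝒪[K] (Fin 3 → K) | M ∈ stratum σ ϖ T ![2 * ρ, 2 * ρ, 2 * ρ] ∧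
        (LatticeInLevel ϖ (d % 2) (Matrix.diagonal ![α - 1, β - 1, 0]) M ∧ ¬ LatticeInLevel ϖ (d % 2 + 1) (Matrix.diagonal ![α - 1, β - 1, 0]) M ∧
          LatticeInLevel ϖ (mcOfRecord d) (Matrix.diagonal ![(α - 1) * (α - 1), (β - 1) * (β - 1), 0]) M)}, w M = 0 := by
  classical
  rw [finsum_mem_sep_eq_ite_of_forall_iff (stratum σ ϖ T ![2 * ρ, 2 * ρ, 2 * ρ]) _ _ (shell_iff_of_mem_stratum_H hD hE hmc hneq T hρ), if_neg hne]

/-- **AT `2ρ + ℓ₀ = min(n₁, n₂)` THE SHELL KEEPS THE WHOLE STRATUM**: the clean-shell cut of `H(ρ)` has the same finsum as `H(ρ)` itself (so FILE 2's per-lattice value is summed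
over the full ★ B7 frame set, weight ★ `finsum_stabiliserWeight_hasAxis_H`). [cite: Kottwitz1986BaseChangeUnits, §1 pp. 240–241] -/
theorem finsum_stratum_H_shell_eq_of_eq (hD : IsRamifiedQuadraticDatum σ ϖ d t) (hE : IsElementDatum σ ϖ N₀ α β n₁ n₂ n₃)
    (hmc : mcOfRecord d ≤ N₀) (hneq : ¬ (n₁ = n₂ ∧ n₂ = n₃)) (T : GL (Fin 3) K) (ρ : ℕ) (hρ : 1 ≤ ρ) (heq : 2 * ρ + d % 2 = min n₁ n₂)
    (w : Submodule 𝒪[K] (Fin 3 → K) → ℚ) :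
    ∑ᶠ M ∈ {M : Submodule 𝒪[K] (Fin 3 → K) | M ∈ stratum σ ϖ T ![2 * ρ, 2 * ρ, 2 * ρ] ∧
        (LatticeInLevel ϖ (d % 2) (Matrix.diagonal ![α - 1, β - 1, 0]) M ∧ ¬ LatticeInLevel ϖ (d % 2 + 1) (Matrix.diagonal ![α - 1, β - 1, 0]) M ∧
          LatticeInLevel ϖ (mcOfRecord d) (Matrix.diagonal ![(α - 1) * (α - 1), (β - 1) * (β - 1), 0]) M)}, w M =
      ∑ᶠ M ∈ stratum σ ϖ T ![2 * ρ, 2 * ρ, 2 * ρ], w M := by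
  classical
  rw [finsum_mem_sep_eq_ite_of_forall_iff (stratum σ ϖ T ![2 * ρ, 2 * ρ, 2 * ρ]) _ _ (shell_iff_of_mem_stratum_H hD hE hmc hneq T hρ), if_pos heq]

end Table

end Summit.HodgeConjecture.HodgeConjecture.Cruxes.H413.F0P3cDyRamLabelledOddCoreHangingShell

end
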